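import Mathlib
import Literature.NumberTheory.LFunctions.Zhang2022.TypedAppendixA1
import Literature.NumberTheory.LFunctions.Zhang2022.AppendixALemma83Kappa
import HarnessLib

/-!
# Zhang (2022), Appendix A part 1 (proof of Lemma 8.3): the local estimates
# `λ̃(q,dh;1−β_j) = (1−u)² + O(α log q/q)` (Z22:§A.u014) and
# `(1−χ(q)q^{−s−β_{j+1}})(1−χ(q)q^{−s−β_{j+2}})/(1−χ(q)q^{−s}) = 1 − vu + O(α log q/q)` (Z22:§A.u015)

Topic `Literature/NumberTheory/LFunctions/Zhang2022` (Landau–Siegel audit tree; verdict-neutral).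
Y. Zhang, *Discrete mean estimates and the Landau–Siegel zero*, arXiv:2211.02515v1 (2022)
[Zhang2022LandauSiegel], Appendix A p. 102 (tex L5047, L5051), **an unrefereed manuscript under
adjudication**. The two displays are the elementary perturbation bounds behind (A.1)–(A.3): every
`q^{−1+w}` with `|w| ≪ α` (`w` a combination of `1 − s` and the shifts `β_i`, `|s − 1| < 5α`,
`q < D`) is within `q⁻¹·2|w| log q` of `u = q⁻¹`, and the rational expressions are Lipschitz. This
file PROVES the typed campaign nodes `Typed.AppendixA1.StepA_u014 c′` and `StepA_u015 c′`
(`stepA_u014_holds`, `stepA_u015_holds`), with explicit absolute constants (`1372`, `504`) valid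
for `D` large in terms of `c′`; Assumption (A) is carried vacuously as in the nodes. Nothing here
bears on Theorems 1–2 of the manuscript.

## References

* Y. Zhang, arXiv:2211.02515v1 (2022), Appendix A p. 102; (2.13). [cite: Zhang2022LandauSiegel, App. A]
-/

noncomputable section

open Complex Real ComplexConjugate Finset

namespace Literature.NumberTheory.LFunctions.Zhang2022.Lemma83

open Literature.NumberTheory.LFunctions.Zhang2022
open Literature.NumberTheory.LFunctions.Zhang2022.Skeleton
open Literature.NumberTheory.LFunctions.Zhang2022.Typed.AppendixA1

/-! ## Generic perturbation bounds -/

/-- `‖q^w − 1‖ ≤ 2|w| log q` for a natural `q ≥ 1` and `|w| log q ≤ 1`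
(`q^w = exp(w log q)` and `|e^z − 1| ≤ 2|z|` for `|z| ≤ 1`). [folklore] -/
private theorem norm_natCast_cpow_sub_one_le {q : ℕ} (hq : 0 < q) {w : ℂ}
    (hw : ‖w‖ * Real.log q ≤ 1) : ‖(q : ℂ) ^ w - 1‖ ≤ 2 * ‖w‖ * Real.log q := by
  have hq0 : (q : ℂ) ≠ 0 := by exact_mod_cast hq.ne'
  have hlog : Complex.log (q : ℂ) = (Real.log q : ℂ) := (Complex.natCast_log).symm
  rw [Complex.cpow_def_of_ne_zero hq0, hlog]
  have hz : ‖(Real.log q : ℂ) * w‖ = ‖w‖ * Real.log q := by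
    rw [norm_mul, Complex.norm_real, Real.norm_eq_abs,
      abs_of_nonneg (Real.log_natCast_nonneg q), mul_comm]
  calc ‖Complex.exp ((Real.log q : ℂ) * w) - 1‖ ≤ 2 * ‖(Real.log q : ℂ) * w‖ :=
        Complex.norm_exp_sub_one_le (by rw [hz]; exact hw)
    _ = 2 * ‖w‖ * Real.log q := by rw [hz]; ring

/-- `q^{−1+w} = q⁻¹·q^w` is within `q⁻¹·2|w| log q` of `u = q⁻¹` (`|w| log q ≤ 1`). [folklore] -/
private theorem norm_cpow_neg_one_add_sub_inv_le {q : ℕ} (hq : 0 < q) {w : ℂ}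
    (hw : ‖w‖ * Real.log q ≤ 1) :
    ‖(q : ℂ) ^ (-1 + w) - (q : ℂ)⁻¹‖ ≤ (q : ℝ)⁻¹ * (2 * ‖w‖ * Real.log q) := by
  have hq0 : (q : ℂ) ≠ 0 := by exact_mod_cast hq.ne'
  rw [Complex.cpow_add _ _ hq0, Complex.cpow_neg_one, ← mul_sub_one, norm_mul, norm_inv,
    Complex.norm_natCast]
  exact mul_le_mul_of_nonneg_left (norm_natCast_cpow_sub_one_le hq hw) (by positivity)

/-- Three-factor Lipschitz bound: if `‖xᵢ − y‖ ≤ δ`, `‖x₀ − y‖ ≤ δ` and all of `‖xᵢ‖, ‖y‖ ≤ 7/4`,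
`‖1 − … ‖`… concretely `‖x₁x₂x₃ − y²x₀‖ ≤ (49/16)·4δ`. [folklore] -/
private theorem norm_mul3_sub_le {x₁ x₂ x₃ x₀ y : ℂ} {δ : ℝ} (h₁ : ‖x₁ - y‖ ≤ δ) (h₂ : ‖x₂ - y‖ ≤ δ)
    (h₃ : ‖x₃ - y‖ ≤ δ) (h₀ : ‖x₀ - y‖ ≤ δ) (n₂ : ‖x₂‖ ≤ 7 / 4) (n₃ : ‖x₃‖ ≤ 7 / 4)
    (ny : ‖y‖ ≤ 7 / 4) : ‖x₁ * x₂ * x₃ - y * y * x₀‖ ≤ 49 / 4 * δ := by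
  have hδ : 0 ≤ δ := le_trans (norm_nonneg _) h₁
  have e : x₁ * x₂ * x₃ - y * y * x₀ =
      (x₁ - y) * x₂ * x₃ + y * (x₂ - y) * x₃ + y * y * ((x₃ - y) - (x₀ - y)) := by ring
  rw [e]
  have t1 : ‖(x₁ - y) * x₂ * x₃‖ ≤ δ * (7 / 4) * (7 / 4) := by
    rw [norm_mul, norm_mul]
    exact mul_le_mul (mul_le_mul h₁ n₂ (norm_nonneg _) hδ) n₃ (norm_nonneg _) (by positivity)
  have t2 : ‖y * (x₂ - y) * x₃‖ ≤ (7 / 4) * δ * (7 / 4) := by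
    rw [norm_mul, norm_mul]
    exact mul_le_mul (mul_le_mul ny h₂ (norm_nonneg _) (by norm_num)) n₃ (norm_nonneg _)
      (by positivity)
  have t3 : ‖y * y * ((x₃ - y) - (x₀ - y))‖ ≤ (7 / 4) * (7 / 4) * (δ + δ) := by
    rw [norm_mul, norm_mul]
    refine mul_le_mul (mul_le_mul ny ny (norm_nonneg _) (by norm_num))
      ((norm_sub_le _ _).trans (add_le_add h₃ h₀)) (norm_nonneg _) (by positivity)
  calc ‖(x₁ - y) * x₂ * x₃ + y * (x₂ - y) * x₃ + y * y * ((x₃ - y) - (x₀ - y))‖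
      ≤ ‖(x₁ - y) * x₂ * x₃‖ + ‖y * (x₂ - y) * x₃‖ + ‖y * y * ((x₃ - y) - (x₀ - y))‖ :=
        norm_add₃_le
    _ ≤ δ * (7 / 4) * (7 / 4) + (7 / 4) * δ * (7 / 4) + (7 / 4) * (7 / 4) * (δ + δ) := by
        linarith
    _ = 49 / 4 * δ := by ring

/-- The shape of `λ̃ = (1−a₁)(1−a₂)(1−a₃)/(1−a₀)` near `aᵢ ≈ u`: if `‖aᵢ − u‖ ≤ δ ≤ 1/4`
(`i = 0,…,3`) and `‖u‖ ≤ 1/2` then `‖λ̃ − (1−u)²‖ ≤ 49δ`. [folklore] -/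
private theorem norm_frac3_sub_sq_le {a₁ a₂ a₃ a₀ u : ℂ} {δ : ℝ} (hδ : δ ≤ 1 / 4)
    (hu : ‖u‖ ≤ 1 / 2) (h₁ : ‖a₁ - u‖ ≤ δ) (h₂ : ‖a₂ - u‖ ≤ δ) (h₃ : ‖a₃ - u‖ ≤ δ)
    (h₀ : ‖a₀ - u‖ ≤ δ) :
    ‖(1 - a₁) * (1 - a₂) * (1 - a₃) / (1 - a₀) - (1 - u) ^ 2‖ ≤ 49 * δ := by
  have hδ0 : 0 ≤ δ := le_trans (norm_nonneg _) h₁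
  have na : ∀ {a : ℂ}, ‖a - u‖ ≤ δ → ‖a‖ ≤ 3 / 4 := fun {a} ha => by
    calc ‖a‖ = ‖(a - u) + u‖ := by ring_nf
      _ ≤ ‖a - u‖ + ‖u‖ := norm_add_le _ _
      _ ≤ 3 / 4 := by linarith
  have nx : ∀ {a : ℂ}, ‖a‖ ≤ 3 / 4 → ‖1 - a‖ ≤ 7 / 4 := fun {a} ha => by
    calc ‖1 - a‖ ≤ ‖(1 : ℂ)‖ + ‖a‖ := norm_sub_le _ _
      _ ≤ 7 / 4 := by rw [norm_one]; linarith
  have hden : 1 / 4 ≤ ‖1 - a₀‖ := by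
    have := norm_sub_norm_le (1 : ℂ) a₀
    rw [norm_one] at this
    linarith [na h₀, abs_norm_sub_norm_le (1 : ℂ) a₀, norm_sub_le (1 : ℂ) a₀,
      norm_le_norm_add_norm_sub' (1 : ℂ) a₀]
  have hden0 : (1 - a₀) ≠ 0 := fun h => by rw [h, norm_zero] at hden; linarith
  have hsub : ∀ {a : ℂ}, ‖a - u‖ ≤ δ → ‖(1 - a) - (1 - u)‖ ≤ δ := fun {a} ha => by
    rw [show (1 - a) - (1 - u) = -(a - u) by ring, norm_neg]; exact ha
  have hN := norm_mul3_sub_le (hsub h₁) (hsub h₂) (hsub h₃) (hsub h₀) (nx (na h₂)) (nx (na h₃))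
    (nx (le_trans hu (by norm_num)))
  have e : (1 - a₁) * (1 - a₂) * (1 - a₃) / (1 - a₀) - (1 - u) ^ 2 =
      ((1 - a₁) * (1 - a₂) * (1 - a₃) - (1 - u) * (1 - u) * (1 - a₀)) / (1 - a₀) := by
    field_simp
  rw [e, norm_div]
  calc ‖(1 - a₁) * (1 - a₂) * (1 - a₃) - (1 - u) * (1 - u) * (1 - a₀)‖ / ‖1 - a₀‖
      ≤ (49 / 4 * δ) / (1 / 4) := div_le_div₀ (by positivity) hN (by norm_num) hden
    _ = 49 * δ := by ring

/-- The shape of the first factor of `𝔱_j`: if `‖X_k − u‖ ≤ δ ≤ 1/4` (`k = 0,1,2`), `‖v‖ ≤ 1`,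
`‖u‖ ≤ 1/2`, then `‖(1−vX₁)(1−vX₂)/(1−vX₀) − (1−vu)‖ ≤ 21δ`. [folklore] -/
private theorem norm_frac2_sub_le {X₁ X₂ X₀ u v : ℂ} {δ : ℝ} (hδ : δ ≤ 1 / 4) (hu : ‖u‖ ≤ 1 / 2)
    (hv : ‖v‖ ≤ 1) (h₁ : ‖X₁ - u‖ ≤ δ) (h₂ : ‖X₂ - u‖ ≤ δ) (h₀ : ‖X₀ - u‖ ≤ δ) :
    ‖(1 - v * X₁) * (1 - v * X₂) / (1 - v * X₀) - (1 - v * u)‖ ≤ 21 * δ := by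
  have hδ0 : 0 ≤ δ := le_trans (norm_nonneg _) h₁
  have na : ∀ {a : ℂ}, ‖a - u‖ ≤ δ → ‖a‖ ≤ 3 / 4 := fun {a} ha => by
    calc ‖a‖ = ‖(a - u) + u‖ := by ring_nf
      _ ≤ ‖a - u‖ + ‖u‖ := norm_add_le _ _
      _ ≤ 3 / 4 := by linarith
  have nva : ∀ {a : ℂ}, ‖a‖ ≤ 3 / 4 → ‖v * a‖ ≤ 3 / 4 := fun {a} ha => by
    rw [norm_mul]; nlinarith [norm_nonneg v, norm_nonneg a]
  have nx : ∀ {a : ℂ}, ‖a‖ ≤ 3 / 4 → ‖1 - v * a‖ ≤ 7 / 4 := fun {a} ha => by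
    calc ‖1 - v * a‖ ≤ ‖(1 : ℂ)‖ + ‖v * a‖ := norm_sub_le _ _
      _ ≤ 7 / 4 := by rw [norm_one]; linarith [nva ha]
  have hsub : ∀ {a : ℂ}, ‖a - u‖ ≤ δ → ‖(1 - v * a) - (1 - v * u)‖ ≤ δ := fun {a} ha => by
    rw [show (1 - v * a) - (1 - v * u) = -(v * (a - u)) by ring, norm_neg, norm_mul]
    nlinarith [norm_nonneg v, norm_nonneg (a - u)]
  have hden : 1 / 4 ≤ ‖1 - v * X₀‖ := by
    linarith [norm_le_norm_add_norm_sub' (1 : ℂ) (v * X₀), nva (na h₀), norm_one (α := ℂ)]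
  have hden0 : (1 - v * X₀) ≠ 0 := fun h => by rw [h, norm_zero] at hden; linarith
  have e : (1 - v * X₁) * (1 - v * X₂) / (1 - v * X₀) - (1 - v * u) =
      ((1 - v * X₁) * (1 - v * X₂) - (1 - v * u) * (1 - v * X₀)) / (1 - v * X₀) := by
    field_simp
  have hN : ‖(1 - v * X₁) * (1 - v * X₂) - (1 - v * u) * (1 - v * X₀)‖ ≤ 21 / 4 * δ := by
    have e2 : (1 - v * X₁) * (1 - v * X₂) - (1 - v * u) * (1 - v * X₀) =
        ((1 - v * X₁) - (1 - v * u)) * (1 - v * X₂) +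
          (1 - v * u) * (((1 - v * X₂) - (1 - v * u)) - ((1 - v * X₀) - (1 - v * u))) := by ring
    rw [e2]
    have t1 : ‖((1 - v * X₁) - (1 - v * u)) * (1 - v * X₂)‖ ≤ δ * (7 / 4) := by
      rw [norm_mul]; exact mul_le_mul (hsub h₁) (nx (na h₂)) (norm_nonneg _) hδ0
    have t2 : ‖(1 - v * u) * (((1 - v * X₂) - (1 - v * u)) - ((1 - v * X₀) - (1 - v * u)))‖ ≤
        (7 / 4) * (δ + δ) := by
      rw [norm_mul]
      exact mul_le_mul (nx (le_trans hu (by norm_num)))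
        ((norm_sub_le _ _).trans (add_le_add (hsub h₂) (hsub h₀))) (norm_nonneg _) (by norm_num)
    calc _ ≤ ‖((1 - v * X₁) - (1 - v * u)) * (1 - v * X₂)‖ +
          ‖(1 - v * u) * (((1 - v * X₂) - (1 - v * u)) - ((1 - v * X₀) - (1 - v * u)))‖ :=
          norm_add_le _ _
      _ ≤ δ * (7 / 4) + (7 / 4) * (δ + δ) := add_le_add t1 t2
      _ = 21 / 4 * δ := by ring
  rw [e, norm_div]
  calc ‖(1 - v * X₁) * (1 - v * X₂) - (1 - v * u) * (1 - v * X₀)‖ / ‖1 - v * X₀‖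
      ≤ (21 / 4 * δ) / (1 / 4) := div_le_div₀ (by positivity) hN (by norm_num) hden
    _ = 21 * δ := by ring

/-! ## The sizes of the shifts -/

/-- `‖β₁‖ = |b₁|`, `‖β₂‖ = |b₂|`, `‖β₃‖ = |b₃|` (`β_i = ib_i`). [cite: Zhang2022LandauSiegel, §2 (2.13)] -/
theorem norm_beta_eq (c' : ℝ) (D : ℕ) :
    ‖beta1 c' D‖ = |b1 c' D| ∧ ‖beta2 c' D‖ = |b2 c' D| ∧ ‖beta3 c' D‖ = |b3 c' D| := by
  refine ⟨?_, ?_, ?_⟩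
  · rw [beta1, b1, norm_mul, norm_mul, Complex.norm_I, one_mul, Complex.norm_real,
      Complex.norm_real, Real.norm_eq_abs, Real.norm_eq_abs, ← abs_mul]
  · rw [beta2, b2, norm_mul, norm_mul, norm_mul, Complex.norm_I, Complex.norm_real,
      Complex.norm_real, Real.norm_eq_abs, Real.norm_eq_abs, Complex.norm_two, mul_one, ← abs_two,
      ← abs_mul, ← abs_mul, abs_two]
  · rw [beta3, b3, norm_mul, norm_mul, norm_mul, Complex.norm_I, Complex.norm_real,
      Complex.norm_real, Real.norm_eq_abs, Real.norm_eq_abs, mul_one]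
    rw [show ‖(3 : ℂ)‖ = |(3 : ℝ)| by simp, ← abs_mul, ← abs_mul]

/-- `‖β_j‖ ≤ |b₁| + |b₂| + |b₃|` for every index `j` (`β_j ∈ {β₁, β₂, β₃}`).
[cite: Zhang2022LandauSiegel, §2 (2.13)] -/
theorem norm_betaJ_le (c' : ℝ) (D : ℕ) (j : ℕ) :
    ‖betaJ c' D j‖ ≤ |b1 c' D| + |b2 c' D| + |b3 c' D| := by
  obtain ⟨h1, h2, h3⟩ := norm_beta_eq c' D
  have a1 := abs_nonneg (b1 c' D); have a2 := abs_nonneg (b2 c' D); have a3 := abs_nonneg (b3 c' D)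
  unfold betaJ
  split_ifs <;> linarith

/-- The standing largeness of `D` used below: `𝓛 ≥ 3` and `10|c′|α𝓛 ≤ 1` (then `|b₁|+|b₂|+|b₃| ≤ 7α`
and `14α𝓛 ≤ 1/8`). [cite: Zhang2022LandauSiegel, §2 (2.10)] -/
theorem largeD_bounds (c' : ℝ) {D : ℕ} (hD : Real.exp (10 * |c'| * π + 400) ≤ D) :
    3 ≤ ell D ∧ 0 < alpha D ∧ |b1 c' D| + |b2 c' D| + |b3 c' D| ≤ 7 * alpha D ∧
      alpha D * ell D ≤ 1 / 112 := by
  have hD0 : (0 : ℝ) < D := lt_of_lt_of_le (Real.exp_pos _) hD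
  have hc0 : 0 ≤ 10 * |c'| * π := by positivity
  have hℓ : 10 * |c'| * π + 400 ≤ ell D := by rw [ell]; exact (Real.le_log_iff_exp_le hD0).mpr hD
  have hℓ3 : 3 ≤ ell D := by linarith
  have hℓ0 : ell D ≠ 0 := by linarith
  have hα : 0 < alpha D := by rw [alpha, bigP, Real.log_exp]; positivity
  have hD' : Real.exp (10 * |c'| * π + 1) ≤ D :=
    le_trans (Real.exp_le_exp.mpr (by linarith)) hD
  have h10 := ten_mul_abs_mul_alpha_ell_le_one c' hD'
  have hB : |b1 c' D| + |b2 c' D| + |b3 c' D| ≤ 7 * alpha D := by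
    have h := sum_abs_b_le c' hα.le (by linarith)
    nlinarith [h, h10, hα]
  have hαℓ : alpha D * ell D ≤ 1 / 112 := by
    rw [alpha_mul_ell hℓ0]
    have h8 : (400 : ℝ) ^ 8 ≤ ell D ^ 8 := pow_le_pow_left₀ (by norm_num) (by linarith) 8
    rw [div_le_div_iff₀ (by positivity) (by norm_num)]
    nlinarith [Real.pi_lt_four, h8]
  exact ⟨hℓ3, hα, hB, hαℓ⟩

/-! ## Z22:§A.u014: `λ̃(q,dh;1−β_j) = (1−u)² + O(α log q/q)` -/

/-- **Z22:§A.u014 holds** (App. A p. 102, tex L5047): for `(q,dh) = 1`, `q < D` prime,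
`‖λ̃(q,dh;1−β_j) − (1−u)²‖ ≤ 1372·α log q/q` (all large `D`; `λ̃(q,dh;1−β_j)` is the single factor
`(1−q^{−1+β_j−β₁})(1−q^{−1+β_j−β₂})(1−q^{−1+β_j−β₃})/(1−q^{−1+β_j})`, each `q^{−1+w}` within
`q⁻¹·2|w|log q` of `u`). [cite: Zhang2022LandauSiegel, App. A p. 102] -/
theorem stepA_u014_holds (c' : ℝ) : StepA_u014 c' := by
  refine ⟨1372, ⌈Real.exp (10 * |c'| * π + 400)⌉₊, fun D _ χ hD _ _ _ j _ d h _ _ _ q hq hqD _ hqdh => ?_⟩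
  have hD' : Real.exp (10 * |c'| * π + 400) ≤ D := le_trans (Nat.le_ceil _) (by exact_mod_cast hD)
  obtain ⟨hℓ3, hα, hB, hαℓ⟩ := largeD_bounds c' hD'
  set B : ℝ := |b1 c' D| + |b2 c' D| + |b3 c' D| with hBdef
  have hq2 : (2 : ℝ) ≤ q := by exact_mod_cast hq.two_le
  have hq0 : (0 : ℝ) < q := by linarith
  have hlogq : Real.log q ≤ ell D := by
    rw [ell]; exact Real.log_le_log hq0 (by exact_mod_cast hqD.le)
  have hlogq0 : 0 ≤ Real.log q := Real.log_nonneg (by linarith)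
  -- the single factor
  have hlam : lamTilde c' D q (d * h) (1 - betaJ c' D j) =
      (1 - (q : ℂ) ^ (-(1 - betaJ c' D j + beta1 c' D))) *
        (1 - (q : ℂ) ^ (-(1 - betaJ c' D j + beta2 c' D))) *
          (1 - (q : ℂ) ^ (-(1 - betaJ c' D j + beta3 c' D))) /
        (1 - (q : ℂ) ^ (-(1 - betaJ c' D j))) := by
    unfold lamTilde
    rw [hq.primeFactors, Finset.filter_singleton, if_pos hqdh, Finset.prod_singleton]
  rw [hlam]
  -- exponents `−1 + w`
  have e1 : -(1 - betaJ c' D j + beta1 c' D) = -1 + (betaJ c' D j - beta1 c' D) := by ring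
  have e2 : -(1 - betaJ c' D j + beta2 c' D) = -1 + (betaJ c' D j - beta2 c' D) := by ring
  have e3 : -(1 - betaJ c' D j + beta3 c' D) = -1 + (betaJ c' D j - beta3 c' D) := by ring
  have e0 : -(1 - betaJ c' D j) = -1 + betaJ c' D j := by ring
  rw [e1, e2, e3, e0]
  obtain ⟨n1, n2, n3⟩ := norm_beta_eq c' D
  have hj := norm_betaJ_le c' D j
  have hw : ∀ {w : ℂ}, ‖w‖ ≤ 2 * B →
      ‖(q : ℂ) ^ (-1 + w) - (q : ℂ)⁻¹‖ ≤ (q : ℝ)⁻¹ * (4 * B * Real.log q) := fun {w} hw => by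
    have hcond : ‖w‖ * Real.log q ≤ 1 := by
      calc ‖w‖ * Real.log q ≤ 2 * B * ell D := mul_le_mul hw hlogq hlogq0 (by positivity)
        _ ≤ 2 * (7 * alpha D) * ell D := by gcongr
        _ ≤ 1 := by nlinarith
    calc ‖(q : ℂ) ^ (-1 + w) - (q : ℂ)⁻¹‖ ≤ (q : ℝ)⁻¹ * (2 * ‖w‖ * Real.log q) :=
          norm_cpow_neg_one_add_sub_inv_le hq.pos hcond
      _ ≤ (q : ℝ)⁻¹ * (4 * B * Real.log q) := by
          apply mul_le_mul_of_nonneg_left _ (by positivity); nlinarith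
  have a1 := abs_nonneg (b1 c' D); have a2 := abs_nonneg (b2 c' D); have a3 := abs_nonneg (b3 c' D)
  have w1 : ‖betaJ c' D j - beta1 c' D‖ ≤ 2 * B := by
    calc _ ≤ ‖betaJ c' D j‖ + ‖beta1 c' D‖ := norm_sub_le _ _
      _ ≤ 2 * B := by rw [n1]; linarith
  have w2 : ‖betaJ c' D j - beta2 c' D‖ ≤ 2 * B := by
    calc _ ≤ ‖betaJ c' D j‖ + ‖beta2 c' D‖ := norm_sub_le _ _
      _ ≤ 2 * B := by rw [n2]; linarith
  have w3 : ‖betaJ c' D j - beta3 c' D‖ ≤ 2 * B := by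
    calc _ ≤ ‖betaJ c' D j‖ + ‖beta3 c' D‖ := norm_sub_le _ _
      _ ≤ 2 * B := by rw [n3]; linarith
  have w0 : ‖betaJ c' D j‖ ≤ 2 * B := by linarith [norm_nonneg (betaJ c' D j)]
  set δ : ℝ := (q : ℝ)⁻¹ * (4 * B * Real.log q) with hδ
  have hu : ‖((q : ℂ))⁻¹‖ ≤ 1 / 2 := by
    rw [norm_inv, Complex.norm_natCast]; exact inv_le_of_inv_le₀ (by norm_num) (by linarith)
  have hδle : δ ≤ 1 / 4 := by
    have : 4 * B * Real.log q ≤ 4 * (7 * alpha D) * ell D := by gcongr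
    have hq' : (q : ℝ)⁻¹ ≤ 1 / 2 := inv_le_of_inv_le₀ (by norm_num) (by linarith)
    calc δ ≤ (1 / 2) * (4 * (7 * alpha D) * ell D) :=
          mul_le_mul hq' this (by positivity) (by norm_num)
      _ ≤ 1 / 4 := by nlinarith
  have key := norm_frac3_sub_sq_le hδle hu (hw w1) (hw w2) (hw w3) (hw w0)
  have huA : uA q = ((q : ℂ))⁻¹ := rfl
  rw [huA]
  calc _ ≤ 49 * δ := key
    _ = 196 * B * (Real.log q / q) := by rw [hδ]; ring
    _ ≤ 196 * (7 * alpha D) * (Real.log q / q) := by gcongr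
    _ = 1372 * (alpha D * Real.log q / q) := by ring

variable (c' : ℝ) in
/-- `StepA_u014` — `_holds` alias of `stepA_u014_holds` above under the fact's exact name, stated under the
prover's own binders as section variables (appended 2026-08-28, D-0026 bookkeeping: the proof term is the
existing theorem of this file; no statement, definition or attribute is edited; no new named fact; the
ledger's debt table listed the fact unproved). [cite: Zhang2022LandauSiegel, App. A p. 102] -/
theorem _root_.Literature.NumberTheory.LFunctions.Zhang2022.Typed.AppendixA1.StepA_u014_holds :
    _root_.Literature.NumberTheory.LFunctions.Zhang2022.Typed.AppendixA1.StepA_u014 c' :=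
  _root_.Literature.NumberTheory.LFunctions.Zhang2022.Lemma83.stepA_u014_holds (c' := c')

/-! ## Z22:§A.u015: the first factor of `𝔱_j` is `1 − vu + O(α log q/q)` -/

/-- **Z22:§A.u015 holds** (App. A p. 102, tex L5051): under `|s − 1| < 5α`, `q < D`, `(q,D) = 1`,
`‖(1−χ(q)q^{−s−β_{j+1}})(1−χ(q)q^{−s−β_{j+2}})/(1−χ(q)q^{−s}) − (1 − vu)‖ ≤ 504·α log q/q`
(all large `D`). [cite: Zhang2022LandauSiegel, App. A p. 102] -/
theorem stepA_u015_holds (c' : ℝ) : StepA_u015 c' := by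
  refine ⟨504, ⌈Real.exp (10 * |c'| * π + 400)⌉₊, fun D _ χ hD _ _ _ j _ q hq s hcond => ?_⟩
  have hD' : Real.exp (10 * |c'| * π + 400) ≤ D := le_trans (Nat.le_ceil _) (by exact_mod_cast hD)
  obtain ⟨hℓ3, hα, hB, hαℓ⟩ := largeD_bounds c' hD'
  obtain ⟨hs, hqD, _⟩ := hcond
  set B : ℝ := |b1 c' D| + |b2 c' D| + |b3 c' D| with hBdef
  have hq2 : (2 : ℝ) ≤ q := by exact_mod_cast hq.two_le
  have hq0 : (0 : ℝ) < q := by linarith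
  have hlogq : Real.log q ≤ ell D := by
    rw [ell]; exact Real.log_le_log hq0 (by exact_mod_cast hqD.le)
  have hlogq0 : 0 ≤ Real.log q := Real.log_nonneg (by linarith)
  -- exponents `−1 + w`
  have e1 : -(s + betaJ c' D (j + 1)) = -1 + ((1 - s) - betaJ c' D (j + 1)) := by ring
  have e2 : -(s + betaJ c' D (j + 2)) = -1 + ((1 - s) - betaJ c' D (j + 2)) := by ring
  have e0 : -s = -1 + (1 - s) := by ring
  unfold pref
  rw [e1, e2, e0]
  have hs' : ‖1 - s‖ ≤ 5 * alpha D := by rw [← norm_neg, neg_sub]; exact hs.le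
  have hw : ∀ {w : ℂ}, ‖w‖ ≤ 12 * alpha D →
      ‖(q : ℂ) ^ (-1 + w) - (q : ℂ)⁻¹‖ ≤ (q : ℝ)⁻¹ * (24 * alpha D * Real.log q) := fun {w} hw => by
    have hcond : ‖w‖ * Real.log q ≤ 1 := by
      calc ‖w‖ * Real.log q ≤ 12 * alpha D * ell D := mul_le_mul hw hlogq hlogq0 (by positivity)
        _ ≤ 1 := by nlinarith
    calc ‖(q : ℂ) ^ (-1 + w) - (q : ℂ)⁻¹‖ ≤ (q : ℝ)⁻¹ * (2 * ‖w‖ * Real.log q) :=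
          norm_cpow_neg_one_add_sub_inv_le hq.pos hcond
      _ ≤ (q : ℝ)⁻¹ * (24 * alpha D * Real.log q) := by
          apply mul_le_mul_of_nonneg_left _ (by positivity); nlinarith
  have hj1 := norm_betaJ_le c' D (j + 1)
  have hj2 := norm_betaJ_le c' D (j + 2)
  have w1 : ‖(1 - s) - betaJ c' D (j + 1)‖ ≤ 12 * alpha D := by
    calc _ ≤ ‖1 - s‖ + ‖betaJ c' D (j + 1)‖ := norm_sub_le _ _
      _ ≤ 12 * alpha D := by linarith
  have w2 : ‖(1 - s) - betaJ c' D (j + 2)‖ ≤ 12 * alpha D := by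
    calc _ ≤ ‖1 - s‖ + ‖betaJ c' D (j + 2)‖ := norm_sub_le _ _
      _ ≤ 12 * alpha D := by linarith
  have w0 : ‖(1 : ℂ) - s‖ ≤ 12 * alpha D := by linarith
  set δ : ℝ := (q : ℝ)⁻¹ * (24 * alpha D * Real.log q) with hδ
  have hu : ‖((q : ℂ))⁻¹‖ ≤ 1 / 2 := by
    rw [norm_inv, Complex.norm_natCast]; exact inv_le_of_inv_le₀ (by norm_num) (by linarith)
  have hv : ‖χ (q : ZMod D)‖ ≤ 1 := χ.norm_le_one _
  have hδle : δ ≤ 1 / 4 := by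
    have : 24 * alpha D * Real.log q ≤ 24 * alpha D * ell D := by gcongr
    have hq' : (q : ℝ)⁻¹ ≤ 1 / 2 := inv_le_of_inv_le₀ (by norm_num) (by linarith)
    calc δ ≤ (1 / 2) * (24 * alpha D * ell D) :=
          mul_le_mul hq' this (by positivity) (by norm_num)
      _ ≤ 1 / 4 := by nlinarith
  have key := norm_frac2_sub_le hδle hu hv (hw w1) (hw w2) (hw w0)
  have huA : uA q = ((q : ℂ))⁻¹ := rfl
  have hvA : vA χ q = χ (q : ZMod D) := rfl
  rw [huA, hvA]
  calc _ ≤ 21 * δ := key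
    _ = 504 * (alpha D * Real.log q / q) := by rw [hδ]; ring

variable (c' : ℝ) in
/-- `StepA_u015` — `_holds` alias of `stepA_u015_holds` above under the fact's exact name, stated under the
prover's own binders as section variables (appended 2026-08-28, D-0026 bookkeeping: the proof term is the
existing theorem of this file; no statement, definition or attribute is edited; no new named fact; the
ledger's debt table listed the fact unproved). [cite: Zhang2022LandauSiegel, App. A p. 102] -/
theorem _root_.Literature.NumberTheory.LFunctions.Zhang2022.Typed.AppendixA1.StepA_u015_holds :
    _root_.Literature.NumberTheory.LFunctions.Zhang2022.Typed.AppendixA1.StepA_u015 c' :=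
  _root_.Literature.NumberTheory.LFunctions.Zhang2022.Lemma83.stepA_u015_holds (c' := c')

end Literature.NumberTheory.LFunctions.Zhang2022.Lemma83
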